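import Literature.MathematicalPhysics.QuantumFieldTheory.Balaban1983to89.B15Prop1CarrierOnSU2Box
import Literature.MathematicalPhysics.QuantumFieldTheory.Balaban1983to89.B15Prop1SliceIneq18

/-!
# `Balaban1983to89.B15Prop1CarrierOnSU2BoxIneq19` — T. Bałaban, *Large field renormalization. I. The basic step of the 𝐑 operation*,
Commun. Math. Phys. **122** (1989) 175–202 [Balaban1989LargeFieldI] («[IV]»), **Proposition 1** p. 194, proof [Balaban1989LargeFieldII]
(«[LF-II]») pp. 357–359: `B15.Prop1Printed` AT THE CARRIER OF RECORD — `SU(2)`, parallelepipeds, print's `x₁`-axial `G₀` (ALL `x₁`-bonds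
ending in `Λ`), the printed chart, the concrete slice coordinates — WITH THE POSITIVITY LETTER (m1) = (1.9) SUPPLIED FROM (1.7):
dag-n12-c's `B15Prop1CarrierOnSU2Box.prop1Printed_lfVarOn_su2_box_slice` (p470158) knitted with `B15Prop1SliceIneq18.ineq19_slice_of_17`
(the `x₁`-axial (1.8) at the slice, `B16Ineq18AxialGauge` p470647, + (1.7) ⇒ (1.9)).

statement-level skeleton of published theorems with citation tags; proofs where landed; nothing here is a claim about
the Yang–Mills mass gap

Cell pub-ymgap, HUMAN RULING D-0062 (Track A full width), seat `pub-ymgap-dag-n12-c` (R134 acceleration seat (a), strategy s1 of DAG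
node N12 = [B15]; generation g2, ninth product).  PDF held: `paper:balaban1989-cmp122-large-field-ii` (journal page = PDF page + 354;
pp. 357–359 = PDF 3–5).

THE PRINT ([LF-II] p. 358–359): *«The inequalities (1.7), (1.8) imply finally ⟨H_{1,k}B′, Δ₁(ζ₀)H_{1,k}B′⟩ ≧ γ₀/(2d(100M)⁵)‖B′‖², (1.9)
for g_k sufficiently small. … By the inequality (1.9) the operator P₀H*_{1,k}Δ₁H_{1,k}P₀ is positive, hence invertible on this subspace,
and the inverse is bounded by (γ₀⁻¹/2)2d(100M)⁵.»*

WHAT THIS FILE PROVES (theorems only; Mathlib + the two imports; no `sorry`, no definition, no `… : Prop` fact; axioms standard).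
§1 (private) `box_toNat_coe` (the integer box `{lo ≤ x ≤ hi}` is `B16Eq18Proof.box (hi − lo + 1) lo`), `mem_G0_image` (the tree `G₀` as an image
   `Finset` has print's shape `⟨castSite (x − e₁), e₁⟩`, `x ∈ Λ`), `gamma_bookkeeping` (`γ = γ₀/10⁹` serves in `hγle` when `K ≤ 100M`).
§2 **`prop1Printed_lfVarOn_su2_box_G0_of_17`** — `B15.Prop1Printed (lfVarOn su2Chart I)` for box instances at `SU(2)` with `T i = G₀`
   and `E i = GaugeSlice (Λ^{(k)}) G₀ ℝ³`, from the hypotheses of `prop1Printed_lfVarOn_su2_box_slice` EXCEPT (m1), which is replaced by: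
   the (1.7) letter `γ₀·Q_i(B′) − C_err,i·‖B′‖² ≤ ⟨H B′, Δ₁ H B′⟩` (`Q_i` = the circulation sum of `B15Prop1SliceIneq18.sliceNormSq_le`),
   the smallness `C_err,i ≤ γ₀/(2c_P,i)` (*«for g_k sufficiently small»*, `c_P,i = 3K_i² + 2K_i⁴`), and the constant bookkeeping
   `γ/M_i⁵ ≤ γ₀/(2c_P,i)` (with `K_i = 100M_i`, `γ = γ₀/10⁹` it holds; displayed), the enlarged non-wrapping margin `n + 5 < sitesPerDir`
   and `K_i ≥ 1`, sides `≤ K_i`.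

HONEST SCOPE.  What remains displayed after this file: (1.7) (the p. 357 perturbation letter identifying the leading form of
`⟨H_{1,k}B′, Δ₁H_{1,k}B′⟩` with `γ₀‖∂B′‖²` up to `O(M⁶R_kε_k + e^{−R_k})‖B′‖²`), (m2)–(m5), (c3) (the expansion pieces OF RECORD: NODE 00),
(c3″) ((181) covariance at print's instance), (x), (ℓ2), thresholds and constant bookkeeping.  Count-neutral; NOT a discharge of N12;
NOT summit progress.
-/

noncomputable section

open Set Finset
open scoped RealInnerProductSpace Real

namespace Literature.MathematicalPhysics.QuantumFieldTheory.Balaban1983to89.B15Prop1CarrierOnSU2BoxIneq19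

open B15DeterminingSets GaugeField B16Sect1Backgrounds B15Prop1Carrier B8Eq17ClassAkV1
open B15Prop1CarrierOnSU2Box B15Prop1SliceIneq18
open T4CubeChartGnomonic (SU2)
open B15Prop1ChartSU2 (su2Chart)
open B15Prop1SliceCoordinates (GaugeSlice ιA freeBonds)
open T4AxialGaugeSmallField (castSite boxPlaqs)
open B7Prop1Explicit (e e_apply)
open B6BondElimination (unitVec unitVec_apply)
open B6TreeGaugePoincare (curl)
open B16Eq18Proof (box mem_box)

variable {P : Params}

/-! ## §1 The box and the tree in the two conventions -/

/-- The integer box `{lo ≤ x ≤ hi}` (`Set.Icc`, the convention of `B15Prop1RelativeAxialGauge` ∕ `B15Prop1CarrierOnSU2Box`) is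
`B16Eq18Proof.box (hi − lo + 1) lo` (side lengths truncated at `0`). [folklore] -/
private theorem box_toNat_coe (lo hi : Fin P.d → ℤ) :
    (↑(box (fun i => (hi i - lo i + 1).toNat) lo) : Set (Fin P.d → ℤ)) = Set.Icc lo hi := by
  ext x
  simp only [Finset.mem_coe, mem_box, Set.mem_Icc]
  constructor
  · intro h
    refine ⟨fun i => (h i).1, fun i => ?_⟩
    have h2 := (h i).2
    have : ((hi i - lo i + 1).toNat : ℤ) ≤ max (hi i - lo i + 1) 0 := by
      rw [Int.toNat_eq_max]
    have hm : max (hi i - lo i + 1) 0 = hi i - lo i + 1 ∨ max (hi i - lo i + 1) 0 = 0 := max_choice _ _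
    rcases hm with hm | hm <;> rw [hm] at this <;> linarith [(h i).1]
  · rintro ⟨h1, h2⟩ i
    refine ⟨h1 i, ?_⟩
    have : (hi i - lo i + 1).toNat = hi i - lo i + 1 := Int.toNat_of_nonneg (by linarith [h1 i, h2 i])
    rw [this]
    linarith [h2 i]

/-- The two unit-vector notations agree. [folklore] -/
private theorem unitVec_eq_e (μ : Fin P.d) : (unitVec μ : Fin P.d → ℤ) = e μ := by
  funext i; simp [unitVec_apply, e_apply]

/-- The tree `G₀` as the image `Finset` of `B15Prop1SliceIneq18` has print's shape: every member is `⟨castSite (x − e₁), e₁⟩` with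
`x ∈ Λ = {lo ≤ x ≤ hi}`. [cite: Balaban1989LargeFieldII, (1.8) p.358] -/
theorem mem_G0_image {k : ℕ} [DecidableEq (PBond P k)] (h0 : 0 < P.d) (lo hi : Fin P.d → ℤ) :
    ∀ b ∈ (box (fun i => (hi i - lo i + 1).toNat) lo).image
        (fun x => (⟨castSite (x - unitVec ⟨0, h0⟩), ⟨0, h0⟩⟩ : PBond P k)),
      ∃ x, x ∈ Set.Icc lo hi ∧ b = ⟨castSite (x - e ⟨0, h0⟩), ⟨0, h0⟩⟩ := by
  intro b hb
  obtain ⟨x, hx, rfl⟩ := Finset.mem_image.1 hb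
  refine ⟨x, ?_, by rw [unitVec_eq_e]⟩
  have : x ∈ (↑(box (fun i => (hi i - lo i + 1).toNat) lo) : Set (Fin P.d → ℤ)) := hx
  rwa [box_toNat_coe] at this

/-- **Constant bookkeeping for `hγle`** (p. 359: *«the inverse is bounded by (γ₀⁻¹/2)2d(100M)⁵»*): with `K ≤ 100M`, `1 ≤ K`,
`1 ≤ M`, the choice `γ = γ₀/10⁹` satisfies `γ/M⁵ ≤ γ₀/(2(3K² + 2K⁴))`. [cite: Balaban1989LargeFieldII, (1.9) p.358, p.359] -/
theorem gamma_bookkeeping {γ₀ M : ℝ} {K : ℕ} (hγ₀ : 0 ≤ γ₀) (hM : 1 ≤ M) (hK1 : 1 ≤ K) (hKM : (K : ℝ) ≤ 100 * M) :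
    γ₀ / 10 ^ 9 / M ^ 5 ≤ γ₀ / (2 * (3 * (K : ℝ) ^ 2 + 2 * (K : ℝ) ^ 4)) := by
  have hK : (1 : ℝ) ≤ K := by exact_mod_cast hK1
  have hK0 : (0 : ℝ) ≤ K := by linarith
  have hden : 0 < 2 * (3 * (K : ℝ) ^ 2 + 2 * (K : ℝ) ^ 4) := by positivity
  have hM5 : 0 < M ^ 5 := by positivity
  rw [div_div]
  refine div_le_div_of_nonneg_left hγ₀ hden ?_
  -- `2(3K² + 2K⁴) ≤ 2(3·10⁴M² + 2·10⁸M⁴) ≤ 10⁹ M⁵`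
  have hK2 : (K : ℝ) ^ 2 ≤ (100 * M) ^ 2 := pow_le_pow_left₀ hK0 hKM 2
  have hK4 : (K : ℝ) ^ 4 ≤ (100 * M) ^ 4 := pow_le_pow_left₀ hK0 hKM 4
  have hM2 : M ^ 2 ≤ M ^ 5 := pow_le_pow_right₀ hM (by norm_num)
  have hM4 : M ^ 4 ≤ M ^ 5 := pow_le_pow_right₀ hM (by norm_num)
  nlinarith

/-! ## §2 Proposition 1 at the carrier of record, (m1) from (1.7) -/

/-- **PROPOSITION 1 [IV] AT THE CARRIER OF RECORD — `SU(2)`, BOXES, `T = G₀` (all `x₁`-bonds ending in `Λ`), PRINTED CHART, SLICE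
COORDINATES — WITH (m1) = (1.9) SUPPLIED FROM THE (1.7) LETTER.**  As `B15Prop1CarrierOnSU2Box.prop1Printed_lfVarOn_su2_box_slice` with
`T i := G₀` (the image `Finset`), except that the positivity hypothesis `hpos` is DERIVED (`B15Prop1SliceIneq18.ineq19_slice_of_17`: the
`x₁`-axial (1.8) at the slice + (1.7) ⇒ (1.9)) from: `h17` (the (1.7) letter per instance and datum), `hsm` (`C_err ≤ γ₀/(2c_P)`, *«for g_k
sufficiently small»*), `hγle` (`γ/M⁵ ≤ γ₀/(2c_P)`, constant bookkeeping), the margin `n′ + 5 < sitesPerDir` and `1 ≤ K`, `n′ ≤ K` for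
the side lengths `n′ = hi − lo + 1`. [cite: Balaban1989LargeFieldI, Prop. 1 (1.77)–(1.78) p.194; Balaban1989LargeFieldII, (1.7)–(1.9)
p.358, pp.358–359 (proof of Proposition 1 [IV]); Balaban1985Variational, Prop. 4 p.293] -/
theorem prop1Printed_lfVarOn_su2_box_G0_of_17 (hd : 2 ≤ P.d) (h0 : 0 < P.d) {ι : Type} (I : ι → InstOn P SU2)
    [∀ i, DecidableEq (PBond P (I i).k)]
    (T : ∀ i, Finset (PBond P (I i).k))
    {F : ι → Type*} [∀ i, NormedAddCommGroup (F i)] [∀ i, InnerProductSpace ℝ (F i)]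
    (H : ∀ i, GaugeField P (I i).k SU2 →
      (GaugeSlice (pts (I i).k (I i).Λ) (T i) (EuclideanSpace ℝ (Fin 3)) →ₗ[ℝ] F i))
    (Hst : ∀ i, GaugeField P (I i).k SU2 →
      (F i →ₗ[ℝ] GaugeSlice (pts (I i).k (I i).Λ) (T i) (EuclideanSpace ℝ (Fin 3))))
    (hadj : ∀ i Vk (x : GaugeSlice (pts (I i).k (I i).Λ) (T i) (EuclideanSpace ℝ (Fin 3))) (y : F i),
      ⟪H i Vk x, y⟫ = ⟪x, Hst i Vk y⟫)
    (Δ₁ : ∀ i, GaugeField P (I i).k SU2 → (F i →ₗ[ℝ] F i)) (dV : ∀ i, GaugeField P (I i).k SU2 → F i → F i)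
    (J : ∀ i, GaugeField P (I i).k SU2 → F i)
    (lo hi : ι → Fin P.d → ℤ) (n : ι → ℕ) (hn : ∀ i κ, hi i κ ≤ lo i κ + n i) (hN : ∀ i, n i + 2 < P.sitesPerDir (I i).k)
    (hbox : ∀ i, pts (I i).k (I i).Λ = (castSite '' Set.Icc (lo i) (hi i) : Set (Site P (I i).k)))
    (hZ : ∀ i, (boxPlaqs (lo i - 1) (hi i + 1) : Set (Plaq P (I i).k)) ⊆ plaqsInside (pts (I i).k (I i).Z))
    (hTG0 : ∀ i, T i = (box (fun κ => (hi i κ - lo i κ + 1).toNat) (lo i)).image fun x =>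
      (⟨castSite (x - unitVec ⟨0, h0⟩), ⟨0, h0⟩⟩ : PBond P (I i).k))
    (hN5 : ∀ i κ, ((hi i κ - lo i κ + 1).toNat : ℤ) + 5 < P.sitesPerDir (I i).k)
    (K : ι → ℕ) (hK1 : ∀ i, 1 ≤ K i) (hKn : ∀ i κ, (hi i κ - lo i κ + 1).toNat ≤ K i)
    (ext : ∀ i, GaugeField P (I i).k SU2 → GaugeField P (I i).k SU2)
    {γ γ₀ h₁ hst cJ bx : ℝ} (hγ : 0 < γ) (hγ₀ : 0 ≤ γ₀) (hh₁ : 0 ≤ h₁) (hhst : 0 ≤ hst) (hcJ : 0 ≤ cJ) (hbx : 0 ≤ bx)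
    {ℓ ρ r eA eD a₁ δc Cerr : ι → ℝ} (hℓ : ∀ i, 0 ≤ ℓ i) (hr : ∀ i, 0 < r i) (heA : ∀ i, 0 < eA i) (heD : ∀ i, 0 < eD i)
    (hδc : ∀ i, 0 < δc i) (ha₁ : ∀ i, 0 ≤ a₁ i) (hM : ∀ i, 1 ≤ (I i).M)
    -- (m1) REPLACED by the (1.7) letter, the smallness and the constant bookkeeping
    (h17 : ∀ i Vk (X : GaugeSlice (pts (I i).k (I i).Λ) (T i) (EuclideanSpace ℝ (Fin 3))),
      γ₀ * (∑ z ∈ box (fun κ => (hi i κ - lo i κ + 1).toNat + 3) (fun κ => lo i κ - 2), ∑ μ : Fin P.d, ∑ a : Fin 3,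
          curl (fun b => ιA (pts (I i).k (I i).Λ) (T i) X (⟨castSite b.1, b.2⟩ : PBond P (I i).k) a) z ⟨0, h0⟩ μ ^ 2) -
        Cerr i * ‖X‖ ^ 2 ≤ ⟪H i Vk X, Δ₁ i Vk (H i Vk X)⟫)
    (hsm : ∀ i, Cerr i ≤ γ₀ / (2 * (3 * (K i : ℝ) ^ 2 + 2 * (K i : ℝ) ^ 4)))
    (hγle : ∀ i, γ / (I i).M ^ 5 ≤ γ₀ / (2 * (3 * (K i : ℝ) ^ 2 + 2 * (K i : ℝ) ^ 4)))
    (hH : ∀ i Vk x, ‖H i Vk x‖ ≤ h₁ * ‖x‖) (hHst : ∀ i Vk z, ‖Hst i Vk z‖ ≤ hst * ‖z‖)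
    (hdV0 : ∀ i Vk, dV i Vk 0 = 0)
    (hdV : ∀ i Vk (u v : F i), ‖u‖ ≤ ρ i → ‖v‖ ≤ ρ i → ‖dV i Vk u - dV i Vk v‖ ≤ ℓ i * ‖u - v‖)
    (hρ : ∀ i, h₁ * r i ≤ ρ i) (hsmall : ∀ i, (I i).M ^ 5 / γ * hst * ℓ i * h₁ ≤ 1 / 2)
    (hA : ∀ i Vk (X δ : GaugeSlice (pts (I i).k (I i).Λ) (T i) (EuclideanSpace ℝ (Fin 3))),
      HasDerivAt (fun s : ℝ => (I i).f (expMul su2Chart (ιA (pts (I i).k (I i).Λ) (T i) (X + s • δ)) (ext i Vk)))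
      (⟪δ, Hst i Vk (J i Vk)⟫ + ⟪δ, Hst i Vk (Δ₁ i Vk (H i Vk X))⟫ + ⟪δ, Hst i Vk (dV i Vk (H i Vk X))⟫) 0)
    (hJ : ∀ i ε Vk, 0 < ε → (lfVarOn su2Chart I).Regular i ε Vk → ‖J i Vk‖ ≤ cJ * ε)
    (hc3 : ∀ i Vk (B : GaugeSlice (pts (I i).k (I i).Λ) (T i) (EuclideanSpace ℝ (Fin 3))), ‖B‖ ≤ r i →
      (IsCriticalPt su2Chart (bondsOf (pts (I i).k (I i).Λ)) (I i).f
          (expMul su2Chart (ιA (pts (I i).k (I i).Λ) (T i) B) (ext i Vk)) ↔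
        ∀ δB : GaugeSlice (pts (I i).k (I i).Λ) (T i) (EuclideanSpace ℝ (Fin 3)),
          ⟪δB, Hst i Vk (J i Vk)⟫ + ⟪δB, Hst i Vk (Δ₁ i Vk (H i Vk B))⟫ + ⟪δB, Hst i Vk (dV i Vk (H i Vk B))⟫ = 0))
    (hc3'' : ∀ i (u : GaugeTransf P (I i).k SU2) (V : GaugeField P (I i).k SU2), IsGaugeOn (pts (I i).k (I i).Λ) u →
      (I i).f (gaugeAct u V) = (I i).f V)
    (hAn : ∀ i ε Vk, 0 < ε → ε ≤ eA i → (lfVarOn su2Chart I).Regular i ε Vk → (I i).An ε Vk)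
    (hdom : ∀ i, (I i).dom = domReg (I i).Z (I i).k (a₁ i))
    (hext0 : ∀ i Vk, ext i Vk ∈ extSet (bondsOf (pts (I i).k (I i).Λ)) Vk)
    (hextZ : ∀ i ε Vk, 0 < ε → ε ≤ eD i → (lfVarOn su2Chart I).Regular i ε Vk →
      ∀ p ∈ plaqsInside (pts (I i).k (I i).Z), dist1 (plaqHol (ext i Vk) p) ≤ bx * (I i).M ^ 2 * ε)
    (hextΛ : ∀ i ε Vk, 0 < ε → (lfVarOn su2Chart I).Regular i ε Vk →
      ∀ p ∈ plaqsOf (pts (I i).k (I i).Λ), dist1 (plaqHol (ext i Vk) p) ≤ bx * (I i).M ^ 2 * ε)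
    -- thresholds (`N i = √|free bonds|`)
    (hN' : ∀ i, Real.sqrt (freeBonds (pts (I i).k (I i).Λ) (T i)).card * (π / 2 * δc i) ≤ r i)
    (hδ : ∀ i ε, 0 < ε → ε ≤ eD i →
      ((n i : ℝ) + 2) * ((n i : ℝ) + P.d) * (a₁ i + (bx * (I i).M ^ 2 * ε + ε)) < δc i)
    (he1 : ∀ i ε, 0 < ε → ε ≤ eD i → (4 * 1 * (2 * (I i).M ^ 5 * hst * cJ / γ) + bx * (I i).M ^ 2) * ε < a₁ i) :
    B15.Prop1Printed (lfVarOn su2Chart I) := by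
  have h1 : 1 < P.d := by omega
  refine prop1Printed_lfVarOn_su2_box_slice hd I T H Hst hadj Δ₁ dV J lo hi n hn hN hbox hZ ⟨0, h0⟩ rfl
    (fun i b hb => mem_G0_image h0 (lo i) (hi i) b (hTG0 i ▸ hb)) ext hγ hh₁ hhst hcJ hbx
    hℓ hr heA heD hδc ha₁ hM ?_ hH hHst hdV0 hdV hρ hsmall hA hJ hc3 hc3'' hAn hdom hext0 hextZ hextΛ hN' hδ he1
  -- (m1) from (1.7) + the `x₁`-axial (1.8) at the slice
  intro i Vk x
  have hS : pts (I i).k (I i).Λ =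
      castSite '' (↑(box (fun κ => (hi i κ - lo i κ + 1).toNat) (lo i)) : Set (Fin P.d → ℤ)) := by
    rw [hbox i, box_toNat_coe]
  have h19 := ineq19_slice_of_17 h0 h1 (hN5 i) (hK1 i) (hKn i ⟨0, h0⟩) (hKn i ⟨1, h1⟩) hS (hTG0 i) (H i Vk) (Δ₁ i Vk)
    hγ₀ (h17 i Vk) (hsm i) x
  exact (mul_le_mul_of_nonneg_right (hγle i) (sq_nonneg _)).trans h19

end Literature.MathematicalPhysics.QuantumFieldTheory.Balaban1983to89.B15Prop1CarrierOnSU2BoxIneq19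

end
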